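import Literature.NumberTheory.LFunctions.Zhang2022.Section8MainTerms
import Literature.NumberTheory.LFunctions.Zhang2022.Section18Certificate

/-!
# Zhang (2022) §§8–9 as ONE functional of the design parameters: the mollifier-pair block behind `𝔠₁`, `𝔠₂`

Trunk T-ANT (NumberTheory/LFunctions). Companion of `Section8Defs` / `Section18Defs` (literal transcription of
(8.13)–(8.23), (9.3)–(9.7) of Y. Zhang, *Discrete mean estimates and the Landau–Siegel zero*, arXiv:2211.02515v1
[Zhang2022LandauSiegel], **an unrefereed manuscript under adjudication — nothing here asserts any of its claims**),
of `Section8MainTerms` (the main terms `𝔣_{jμ}`, `𝔤_{jμ}` of Lemmas 8.2/8.4 and their specialisation to the twelve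
printed profiles) and of `Section8ClosedForm` / `Section8Certificate` / `Section18Certificate` (closed forms and
kernel interval enclosures at the printed parameters).

**Purpose (repair-or-barrier question for the §18 margin, cf. `Section2MainOrder`, `Section18AllIota`).** The tree
certifies that the printed assembly `𝔠₁ + 𝔠₂ + 2 Re 𝔠₃ < 0.001` fails at the PRINTED design
(`P₁, P₂, P₃ = P^{0.504}, P^{0.5}T^{−10}, P^{0.498}`, `β₆, β₇ = 3iα/2, 5iα/2`, `ι₂, ι₃, ι₄` of (2.26)) and for every
`ι ∈ ℂ³` with the other data printed. To ask the same question for OTHER admissible designs one needs `𝔠₁`, `𝔠₂`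
as explicit functionals of the design. This file supplies that for §§8–9, where the printed text computes the SAME
functional twice: with

* `k_L, k_S ∈ ℚ` — the multipliers of the two shifts (`β_μ = k_μ·iα`; printed `k₆ = 3/2`, `k₇ = 5/2`),
* `ν_L ≥ ν_S` — the logarithmic lengths `log P_μ / log P` of the LONGER and the SHORTER component of the pair
  (printed: §8 `(ν₁, ν₂) = (0.504, 0.5)`, §9 `(ν₂, ν₃) = (0.5, 0.498)`; the factor `T^{−10}` of `P₂` is invisible
  at main order),
* `u_L, u_S ∈ ℂ` — the coefficients of the two components (§8: `(1, ι₂)` in `a₁₁ = χ(𝔳𝔨₁ + ι₂𝔳𝔨₂)` (8.8);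
  §9: `(ῑ₄, ῑ₃)` in `a₁₂ = χ(ῑ₃𝔳𝔨₃ + ῑ₄𝔳𝔨₂)` (9.2)),

the main-order constant of `2 Re Θ₁` is the Hermitian form
`pairForm k_L k_S ν_L ν_S u_L u_S = |u_L|² c_LL + u_L ū_S c_LS + ū_L u_S c̄_LS + |u_S|² c_SS` with
`c_LL = b_LL + b̄_LL`, `b_LL = (ν_L²π)⁻¹ ∫₀^{ν_L} Σ_j w_j 𝔣𝔣_{jL} 𝔤𝔥_{jL}` ((8.19), (8.20), (9.3), (9.4)),
`c_LS = b_Y + b̄_X`, `b_Y = (ν_Lν_Sπ)⁻¹ ∫₀^{ν_S} Σ_j w_j 𝔣𝔣_{jL}(z + ν_L − ν_S) 𝔤𝔥_{jS}(z)` ((8.22), (9.5)),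
`b_X = (ν_Lν_Sπ)⁻¹ ∫₀^{ν_S} Σ_j w_j 𝔣𝔣_{jS}(z) 𝔤𝔥_{jL}(z + ν_L − ν_S)` ((8.21), (9.6)), weights
`(w₁, w₂, w₃) = (1/2, 2, 3/2)`, and profiles (Lemmas 8.2/8.4 at the main values `β_j = jiα`, `j = 1, 2, 3`, with the
cyclic convention `β₄ = β₁`, `β₅ = β₂`): `𝔣𝔣_{jμ} = ffF (k_μ − j) k_μ`,
`𝔤𝔥_{jμ} = ghF (j′j″/k_μ²) (1 − j′j″/k_μ²) (j′ + j″ − k_μ − j′j″/k_μ) k_μ`, `{j, j′, j″} = {1, 2, 3}`.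

**Results (all kernel-checked; axioms `propext`, `Classical.choice`, `Quot.sound`).**
* `frakf_main`, `frakg_main` — `Section8MainTerms`' twelve specialisation lemmas as TWO statements for arbitrary
  rational indices: `𝔣_{jk}(Pᶻ) = ffMain k j z`, `𝔤(Pᶻ) = ghMain k j′ j″ z` (`αlog P = π`, `k ≠ 0`); the printed
  (8.13)–(8.18) are `ffMain`/`ghMain` at `k ∈ {3/2, 5/2}` (`ffMain_six_one`, …, `ghMain_seven_three`).
* **Faithfulness**: `b11_eq_bDiag`, `b22_eq_bDiag`, `b33_eq_bDiag`, `b12_eq_bCrossY`, `b21_eq_bCrossX`,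
  `b34c_eq_bCrossY`, `b43c_eq_bCrossX`, and `frakc1_eq_pairForm : 𝔠₁ = pairForm (3/2) (5/2) 0.504 0.5 1 ι₂`,
  `frakc2c_eq_pairForm : 𝔠₂ᶜ = pairForm (5/2) (3/2) 0.5 0.498 ῑ₄ ῑ₃` — the printed constants ARE this functional
  at the printed design (so its transcription is checked by the kernel, not by eye). For (9.5)–(9.6) the functional
  carries the prefactor `1/(ν_Lν_Sπ) = 1/((0.5)(0.498)π)` that the substitution `x = Pᶻ` produces
  (`Section18Defs.b34c`; derived in `Section9Discharge.ded9u006c_holds`); the PRINTED prefactor `1/((0.504)(0.498)π)`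
  is recorded as the literal identities `b34_eq_smul_b34c`, `b43_eq_smul_b43c` (factor `125/126`) — it is produced
  by no step of §9 and has no meaning off the printed design.
* `conj_pairForm`, `pairForm_im`, `pairForm_re` — the form is real for every design.
* Closed forms (`FGint`/`FGYint`/`FGXint`) and kernel enclosures at any RATIONAL design (boxes, `mem` lemmas,
  certificate readers, a regression at the printed design) are in the companion `RepairSection9ThetaCert.lean`.

**Deliberately baked (structural, documented levers, NOT parameters of this file):** the main values
`β_j = jiα`, `j = 1,2,3` of (2.13) and hence the weights `(1/2, 2, 3/2)` (= `iℜ_jp^{−β_j}α` of Proposition 7.1,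
the residues of `ζ(s+β₁)ζ(s+β₂)ζ(s+β₃)/ζ(s)` at `1 − β_j`) and the index products `j′j″ = 6, 3, 2`; two components
per mollifier; the linear taper `1 − log n/log P_μ` of (2.23)–(2.25). What is NOT here: `𝔠₃` (§§12–18) and the
§10 constants `𝔡′, 𝔡, C₂₃₃` as functionals (companion files), any admissibility condition on the design (the
hypotheses of Lemmas 8.2–8.4, Proposition 7.1, §9: e.g. `ν_S ≤ ν_L`, `|k_μ| < 5`), and any statement about
Theorems 1–2 of the manuscript.
-/

noncomputable section

open Complex Real ComplexConjugate
open Literature.Analysis.ValidatedNumerics.Numerics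

namespace Literature.NumberTheory.LFunctions.Zhang2022

/-! ### The profiles of Lemmas 8.2/8.4 at the main values, for arbitrary rational indices -/

/-- `𝔣𝔣_{jμ}` for a component with shift multiplier `k` (`β_μ = kiα`) against the residue at `β_j = jiα`:
`ffMain k j z = (1 + (k − j)πiz)e^{kπiz}` (`= ffF (k − j) k z`). Printed instances: `k = 3/2` gives
`𝔣𝔣₁₆, 𝔣𝔣₂₆, 𝔣𝔣₃₆`, `k = 5/2` gives `𝔣𝔣₁₇, 𝔣𝔣₂₇, 𝔣𝔣₃₇` ((8.13)–(8.18)).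
[cite: Zhang2022LandauSiegel, Lemma 8.2 and (8.13)–(8.18)] -/
def ffMain (k j : ℚ) : ℝ → ℂ := ffF (k - j) k

/-- coefficient `r₀ = β_{j′}β_{j″}/β_μ² = j′j″/k²` of `𝔤_{jμ}` at the main values.
[cite: Zhang2022LandauSiegel, Lemma 8.4] -/
def r0Main (k j1 j2 : ℚ) : ℚ := j1 * j2 / k ^ 2

/-- coefficient `b = −(β_{j′} − β_μ)(β_{j″} − β_μ)/(β_μ·iα) = j′ + j″ − k − j′j″/k` of `𝔤_{jμ}` at the main values.
[cite: Zhang2022LandauSiegel, Lemma 8.4] -/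
def bMain (k j1 j2 : ℚ) : ℚ := j1 + j2 - k - j1 * j2 / k

/-- `𝔤𝔥_{jμ}` for a component with shift multiplier `k` against the complementary pair `(β_{j′}, β_{j″}) =
(j′iα, j″iα)`: `ghMain k j′ j″ z = r₀ + (1 − r₀ + bπiz)e^{−kπiz}`, `r₀ = j′j″/k²`, `b = j′ + j″ − k − j′j″/k`
(`= ghF r₀ (1 − r₀) b k z`). Printed instances: `(j′, j″) = (2,3), (3,1), (1,2)` for `j = 1, 2, 3` (convention
`β₄ = β₁, β₅ = β₂`), `k = 3/2, 5/2` ((8.13)–(8.18)). [cite: Zhang2022LandauSiegel, Lemma 8.4 and (8.13)–(8.18)] -/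
def ghMain (k j1 j2 : ℚ) : ℝ → ℂ := ghF (r0Main k j1 j2) (1 - r0Main k j1 j2) (bMain k j1 j2) k

/-- `ffMain` is continuous. [cite: Zhang2022LandauSiegel, (8.13)–(8.18) p.49] -/
@[fun_prop] theorem continuous_ffMain (k j : ℚ) : Continuous (ffMain k j) := by
  unfold ffMain; fun_prop

/-- `ghMain` is continuous. [cite: Zhang2022LandauSiegel, (8.13)–(8.18) p.49] -/
@[fun_prop] theorem continuous_ghMain (k j1 j2 : ℚ) : Continuous (ghMain k j1 j2) := by
  unfold ghMain; fun_prop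

section MainValues

variable {α Λ : ℝ}

/-- **Lemma 8.2's main term at the main values, all indices at once**: with `β_j = jiα`, `β_μ = kiα`,
`x = Pᶻ` (`log x = z log P`) and `α log P = π` ((2.10)), `𝔣_{jμ}(Pᶻ) = ffMain k j z`. The six lemmas
`Section8MainTerms.frakf_main_16 … frakf_main_37` are the cases `(j, k) ∈ {1,2,3} × {3/2, 5/2}`.
[cite: Zhang2022LandauSiegel, Lemma 8.2, (8.13)–(8.18)] -/
theorem frakf_main (h : α * Λ = π) (j k : ℚ) (z : ℝ) :
    frakf (betaMain j α) (betaMain k α) (z * Λ) = ffMain k j z := by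
  have hπ : (π : ℂ) = (α : ℂ) * Λ := by rw [← Complex.ofReal_mul, h]
  unfold frakf betaMain ffMain ffF
  rw [hπ]; push_cast
  congr 1
  · ring
  · congr 1; ring

/-- **Lemma 8.4's main term at the main values, all indices at once**: with `(β_{j′}, β_{j″}) = (j′iα, j″iα)`,
`β_μ = kiα`, `k ≠ 0`, `α ≠ 0`, `α log P = π`: `𝔤_{jμ}(Pᶻ) = ghMain k j′ j″ z`. The six lemmas
`Section8MainTerms.frakg_main_16 … frakg_main_37` are the printed cases.
[cite: Zhang2022LandauSiegel, Lemma 8.4, (8.13)–(8.18)] -/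
theorem frakg_main (hα : α ≠ 0) (h : α * Λ = π) (j1 j2 k : ℚ) (hk : k ≠ 0) (z : ℝ) :
    frakg (betaMain j1 α) (betaMain j2 α) (betaMain k α) (z * Λ) = ghMain k j1 j2 z := by
  have hπ : (π : ℂ) = (α : ℂ) * Λ := by rw [← Complex.ofReal_mul, h]
  have hα' : (α : ℂ) ≠ 0 := by exact_mod_cast hα
  have hk' : (k : ℂ) ≠ 0 := by exact_mod_cast hk
  unfold frakg betaMain ghMain ghF r0Main bMain
  rw [hπ]; push_cast
  congr 1
  · field_simp
  · congr 1
    · field_simp; ring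
    · ring

end MainValues

/-! ### The printed profiles are `ffMain` / `ghMain` at `k = 3/2, 5/2` -/

/-- (8.13): `𝔣𝔣₁₆ = ffMain (3/2) 1`. [cite: Zhang2022LandauSiegel, (8.13)] -/
theorem ffMain_six_one : ffMain (3/2) 1 = ff16 := by unfold ffMain ff16; norm_num
/-- (8.14): `𝔣𝔣₂₆ = ffMain (3/2) 2`. [cite: Zhang2022LandauSiegel, (8.14)] -/
theorem ffMain_six_two : ffMain (3/2) 2 = ff26 := by unfold ffMain ff26; norm_num
/-- (8.15): `𝔣𝔣₃₆ = ffMain (3/2) 3`. [cite: Zhang2022LandauSiegel, (8.15)] -/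
theorem ffMain_six_three : ffMain (3/2) 3 = ff36 := by unfold ffMain ff36; norm_num
/-- (8.16): `𝔣𝔣₁₇ = ffMain (5/2) 1`. [cite: Zhang2022LandauSiegel, (8.16)] -/
theorem ffMain_seven_one : ffMain (5/2) 1 = ff17 := by unfold ffMain ff17; norm_num
/-- (8.17): `𝔣𝔣₂₇ = ffMain (5/2) 2`. [cite: Zhang2022LandauSiegel, (8.17)] -/
theorem ffMain_seven_two : ffMain (5/2) 2 = ff27 := by unfold ffMain ff27; norm_num
/-- (8.18): `𝔣𝔣₃₇ = ffMain (5/2) 3`. [cite: Zhang2022LandauSiegel, (8.18)] -/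
theorem ffMain_seven_three : ffMain (5/2) 3 = ff37 := by unfold ffMain ff37; norm_num
/-- (8.13): `𝔤𝔥₁₆ = ghMain (3/2) 2 3` (`8/3`, `−5/3`, `−1/2`). [cite: Zhang2022LandauSiegel, (8.13)] -/
theorem ghMain_six_one : ghMain (3/2) 2 3 = gh16 := by unfold ghMain r0Main bMain gh16; norm_num
/-- (8.14): `𝔤𝔥₂₆ = ghMain (3/2) 3 1` (`4/3`, `−1/3`, `1/2`). [cite: Zhang2022LandauSiegel, (8.14)] -/
theorem ghMain_six_two : ghMain (3/2) 3 1 = gh26 := by unfold ghMain r0Main bMain gh26; norm_num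
/-- (8.15): `𝔤𝔥₃₆ = ghMain (3/2) 1 2` (`8/9`, `1/9`, `1/6`). [cite: Zhang2022LandauSiegel, (8.15)] -/
theorem ghMain_six_three : ghMain (3/2) 1 2 = gh36 := by unfold ghMain r0Main bMain gh36; norm_num
/-- (8.16): `𝔤𝔥₁₇ = ghMain (5/2) 2 3` (`24/25`, `1/25`, `1/10`). [cite: Zhang2022LandauSiegel, (8.16)] -/
theorem ghMain_seven_one : ghMain (5/2) 2 3 = gh17 := by unfold ghMain r0Main bMain gh17; norm_num
/-- (8.17): `𝔤𝔥₂₇ = ghMain (5/2) 3 1` (`12/25`, `13/25`, `3/10`). [cite: Zhang2022LandauSiegel, (8.17)] -/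
theorem ghMain_seven_two : ghMain (5/2) 3 1 = gh27 := by unfold ghMain r0Main bMain gh27; norm_num
/-- (8.18): `𝔤𝔥₃₇ = ghMain (5/2) 1 2` (`8/25`, `17/25`, `−3/10`). [cite: Zhang2022LandauSiegel, (8.18)] -/
theorem ghMain_seven_three : ghMain (5/2) 1 2 = gh37 := by unfold ghMain r0Main bMain gh37; norm_num

/-! ### The mollifier-pair block: `b`, `c` and the Hermitian form, as functionals of the design -/

/-- the weighted diagonal integrand `Σ_j w_j 𝔣𝔣_{jμ}(z) 𝔤𝔥_{jμ}(z)` of (8.19), (8.20), (9.3) for shift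
multiplier `k`, weights `(1/2, 2, 3/2)`. [cite: Zhang2022LandauSiegel, (8.19)–(8.20), (9.3)] -/
def diagIntegrand (k : ℚ) (z : ℝ) : ℂ :=
  1/2 * (ffMain k 1 z * ghMain k 2 3 z) + 2 * (ffMain k 2 z * ghMain k 3 1 z)
    + 3/2 * (ffMain k 3 z * ghMain k 1 2 z)

/-- the weighted cross integrand `Σ_j w_j 𝔣𝔣_{jL}(z + s) 𝔤𝔥_{jS}(z)` of (8.22), (9.5) (longer component's
`𝔣𝔣` shifted by `s = ν_L − ν_S`, shorter component's `𝔤𝔥`). [cite: Zhang2022LandauSiegel, (8.22), (9.5)] -/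
def crossYIntegrand (kL kS : ℚ) (s z : ℝ) : ℂ :=
  1/2 * (ffMain kL 1 (z + s) * ghMain kS 2 3 z) + 2 * (ffMain kL 2 (z + s) * ghMain kS 3 1 z)
    + 3/2 * (ffMain kL 3 (z + s) * ghMain kS 1 2 z)

/-- the weighted cross integrand `Σ_j w_j 𝔣𝔣_{jS}(z) 𝔤𝔥_{jL}(z + s)` of (8.21), (9.6).
[cite: Zhang2022LandauSiegel, (8.21), (9.6)] -/
def crossXIntegrand (kL kS : ℚ) (s z : ℝ) : ℂ :=
  1/2 * (ffMain kS 1 z * ghMain kL 2 3 (z + s)) + 2 * (ffMain kS 2 z * ghMain kL 3 1 (z + s))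
    + 3/2 * (ffMain kS 3 z * ghMain kL 1 2 (z + s))

/-- **diagonal entry** `b_μμ = (ν²π)⁻¹ ∫₀^ν Σ_j w_j 𝔣𝔣_{jμ} 𝔤𝔥_{jμ}` of a component of logarithmic length `ν`
and shift multiplier `k`: (8.19) is `bDiag (3/2) 0.504`, (8.20) = (9.4) is `bDiag (5/2) 0.5`, (9.3) is
`bDiag (3/2) 0.498`. [cite: Zhang2022LandauSiegel, (8.19), (8.20), (9.3), (9.4)] -/
def bDiag (k : ℚ) (ν : ℝ) : ℂ := ((1 / (ν ^ 2 * π) : ℝ) : ℂ) * ∫ z in (0:ℝ)..ν, diagIntegrand k z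

/-- **cross entry, longer `𝔣𝔣` shifted**: `b_Y = (ν_Lν_Sπ)⁻¹ ∫₀^{ν_S} Σ_j w_j 𝔣𝔣_{jL}(z + ν_L − ν_S)𝔤𝔥_{jS}(z)`:
(8.22) `b₁₂ = bCrossY (3/2) (5/2) 0.504 0.5`; (9.5) in the derived-prefactor reading
`b34c = bCrossY (5/2) (3/2) 0.5 0.498`. [cite: Zhang2022LandauSiegel, (8.22), (9.5)] -/
def bCrossY (kL kS : ℚ) (νL νS : ℝ) : ℂ :=
  ((1 / (νL * νS * π) : ℝ) : ℂ) * ∫ z in (0:ℝ)..νS, crossYIntegrand kL kS (νL - νS) z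

/-- **cross entry, longer `𝔤𝔥` shifted**: `b_X = (ν_Lν_Sπ)⁻¹ ∫₀^{ν_S} Σ_j w_j 𝔣𝔣_{jS}(z)𝔤𝔥_{jL}(z + ν_L − ν_S)`:
(8.21) `b₂₁ = bCrossX (3/2) (5/2) 0.504 0.5`; (9.6) in the derived-prefactor reading
`b43c = bCrossX (5/2) (3/2) 0.5 0.498`. [cite: Zhang2022LandauSiegel, (8.21), (9.6)] -/
def bCrossX (kL kS : ℚ) (νL νS : ℝ) : ℂ :=
  ((1 / (νL * νS * π) : ℝ) : ℂ) * ∫ z in (0:ℝ)..νS, crossXIntegrand kL kS (νL - νS) z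

/-- `c_μμ = b_μμ + b̄_μμ` (`c₁₁, c₂₂ = c₄₄, c₃₃`). [cite: Zhang2022LandauSiegel, §8 after (8.23), §9 after (9.7)] -/
def cDiag (k : ℚ) (ν : ℝ) : ℂ := bDiag k ν + conj (bDiag k ν)

/-- `c_LS = b_Y + b̄_X` (`c₁₂ = b₁₂ + b̄₂₁`; `c₃₄ = b₃₄ + b̄₄₃`). [cite: Zhang2022LandauSiegel, §8 after (8.23), §9 after (9.7)] -/
def cCross (kL kS : ℚ) (νL νS : ℝ) : ℂ := bCrossY kL kS νL νS + conj (bCrossX kL kS νL νS)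

/-- **the Hermitian form of a mollifier pair**: `|u_L|²c_LL + u_Lū_S c_LS + ū_Lu_S c̄_LS + |u_S|²c_SS`, the
main-order constant of `2Re Θ₁` for the pair (display after (8.23): `𝔠₁` with `(u_L, u_S) = (1, ι₂)`; display
after (9.7): `𝔠₂` with `(u_L, u_S) = (ῑ₄, ῑ₃)`). [cite: Zhang2022LandauSiegel, §8 (8.23), §9 (9.7)] -/
def pairForm (kL kS : ℚ) (νL νS : ℝ) (uL uS : ℂ) : ℂ :=
  (Complex.normSq uL : ℂ) * cDiag kL νL + uL * conj uS * cCross kL kS νL νS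
    + conj uL * uS * conj (cCross kL kS νL νS) + (Complex.normSq uS : ℂ) * cDiag kS νS

/-! ### Faithfulness: the printed constants are the functional at the printed design -/

/-- (8.19): `b₁₁ = bDiag (3/2) 0.504`. [cite: Zhang2022LandauSiegel, (8.19)] -/
theorem b11_eq_bDiag : b11 = bDiag (3/2) 0.504 := by
  unfold b11 bDiag diagIntegrand
  simp only [ffMain_six_one, ffMain_six_two, ffMain_six_three, ghMain_six_one, ghMain_six_two,
    ghMain_six_three]

/-- (8.20): `b₂₂ = bDiag (5/2) 0.5`. [cite: Zhang2022LandauSiegel, (8.20)] -/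
theorem b22_eq_bDiag : b22 = bDiag (5/2) 0.5 := by
  unfold b22 bDiag diagIntegrand
  simp only [ffMain_seven_one, ffMain_seven_two, ffMain_seven_three, ghMain_seven_one, ghMain_seven_two,
    ghMain_seven_three]

/-- (9.3): `b₃₃ = bDiag (3/2) 0.498`. [cite: Zhang2022LandauSiegel, (9.3)] -/
theorem b33_eq_bDiag : b33 = bDiag (3/2) 0.498 := by
  unfold b33 bDiag diagIntegrand
  simp only [ffMain_six_one, ffMain_six_two, ffMain_six_three, ghMain_six_one, ghMain_six_two,
    ghMain_six_three]

/-- (9.4): `b₄₄ = bDiag (5/2) 0.5`. [cite: Zhang2022LandauSiegel, (9.4)] -/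
theorem b44_eq_bDiag : b44 = bDiag (5/2) 0.5 := b22_eq_bDiag

/-- (8.22): `b₁₂ = bCrossY (3/2) (5/2) 0.504 0.5` (shift `0.504 − 0.5 = 0.004`). [cite: Zhang2022LandauSiegel, (8.22)] -/
theorem b12_eq_bCrossY : b12 = bCrossY (3/2) (5/2) 0.504 0.5 := by
  unfold b12 bCrossY crossYIntegrand
  simp only [ffMain_six_one, ffMain_six_two, ffMain_six_three, ghMain_seven_one, ghMain_seven_two,
    ghMain_seven_three]
  norm_num

/-- (8.21): `b₂₁ = bCrossX (3/2) (5/2) 0.504 0.5`. [cite: Zhang2022LandauSiegel, (8.21)] -/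
theorem b21_eq_bCrossX : b21 = bCrossX (3/2) (5/2) 0.504 0.5 := by
  unfold b21 bCrossX crossXIntegrand
  simp only [ffMain_seven_one, ffMain_seven_two, ffMain_seven_three, ghMain_six_one, ghMain_six_two,
    ghMain_six_three]
  norm_num

/-- (9.5), derived prefactor `1/((0.5)(0.498)π)`: `b34c = bCrossY (5/2) (3/2) 0.5 0.498` (shift `0.002`).
[cite: Zhang2022LandauSiegel, (9.5)] -/
theorem b34c_eq_bCrossY : b34c = bCrossY (5/2) (3/2) 0.5 0.498 := by
  unfold b34c bCrossY crossYIntegrand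
  simp only [ffMain_seven_one, ffMain_seven_two, ffMain_seven_three, ghMain_six_one, ghMain_six_two,
    ghMain_six_three]
  norm_num

/-- (9.6), derived prefactor: `b43c = bCrossX (5/2) (3/2) 0.5 0.498`. [cite: Zhang2022LandauSiegel, (9.6)] -/
theorem b43c_eq_bCrossX : b43c = bCrossX (5/2) (3/2) 0.5 0.498 := by
  unfold b43c bCrossX crossXIntegrand
  simp only [ffMain_six_one, ffMain_six_two, ffMain_six_three, ghMain_seven_one, ghMain_seven_two,
    ghMain_seven_three]
  norm_num

/-- (9.5) AS PRINTED differs from the derived reading by the constant factor `0.5/0.504 = 125/126`: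
`b₃₄ = (125/126)·b34c`. [cite: Zhang2022LandauSiegel, (9.5)] -/
theorem b34_eq_smul_b34c : b34 = ((125 / 126 : ℝ) : ℂ) * b34c := by
  unfold b34 b34c
  rw [← mul_assoc, ← Complex.ofReal_mul]
  congr 2
  field_simp
  norm_num

/-- (9.6) AS PRINTED: `b₄₃ = (125/126)·b43c`. [cite: Zhang2022LandauSiegel, (9.6)] -/
theorem b43_eq_smul_b43c : b43 = ((125 / 126 : ℝ) : ℂ) * b43c := by
  unfold b43 b43c
  rw [← mul_assoc, ← Complex.ofReal_mul]
  congr 2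
  field_simp
  norm_num

/-- `c₁₁ = cDiag (3/2) 0.504`. [cite: Zhang2022LandauSiegel, §8 after (8.23)] -/
theorem c11_eq_cDiag : c11 = cDiag (3/2) 0.504 := by unfold c11 cDiag; rw [b11_eq_bDiag]
/-- `c₂₂ = cDiag (5/2) 0.5`. [cite: Zhang2022LandauSiegel, §8 after (8.23)] -/
theorem c22_eq_cDiag : c22 = cDiag (5/2) 0.5 := by unfold c22 cDiag; rw [b22_eq_bDiag]
/-- `c₃₃ = cDiag (3/2) 0.498`. [cite: Zhang2022LandauSiegel, §9 after (9.7)] -/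
theorem c33_eq_cDiag : c33 = cDiag (3/2) 0.498 := by unfold c33 cDiag; rw [b33_eq_bDiag]
/-- `c₄₄ = cDiag (5/2) 0.5`. [cite: Zhang2022LandauSiegel, §9 after (9.7)] -/
theorem c44_eq_cDiag : c44 = cDiag (5/2) 0.5 := c22_eq_cDiag
/-- `c₁₂ = cCross (3/2) (5/2) 0.504 0.5`. [cite: Zhang2022LandauSiegel, §8 after (8.23)] -/
theorem c12_eq_cCross : c12 = cCross (3/2) (5/2) 0.504 0.5 := by
  unfold c12 cCross; rw [b12_eq_bCrossY, b21_eq_bCrossX]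
/-- `c34c = cCross (5/2) (3/2) 0.5 0.498` (derived prefactor). [cite: Zhang2022LandauSiegel, §9 after (9.7)] -/
theorem c34c_eq_cCross : c34c = cCross (5/2) (3/2) 0.5 0.498 := by
  unfold c34c cCross; rw [b34c_eq_bCrossY, b43c_eq_bCrossX]
/-- `c₃₄` as printed `= (125/126)·c34c`. [cite: Zhang2022LandauSiegel, §9 after (9.7)] -/
theorem c34_eq_smul_c34c : c34 = ((125 / 126 : ℝ) : ℂ) * c34c := by
  unfold c34 c34c
  rw [b34_eq_smul_b34c, b43_eq_smul_b43c, map_mul, Complex.conj_ofReal]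
  ring

/-- **`𝔠₁` is the pair form at the printed §8 design**: `𝔠₁ = pairForm (3/2) (5/2) 0.504 0.5 1 ι₂`
(longer component `P₁ = P^{0.504}` with `β₆`, coefficient `1`; shorter `P₂ = P^{0.5}` with `β₇`, coefficient `ι₂`).
[cite: Zhang2022LandauSiegel, (8.23)] -/
theorem frakc1_eq_pairForm : frakc1 = pairForm (3/2) (5/2) 0.504 0.5 1 iota2 := by
  unfold frakc1 pairForm c21
  rw [c11_eq_cDiag, c22_eq_cDiag, c12_eq_cCross]
  simp only [map_one, Complex.ofReal_one, one_mul]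
  ring

/-- **`𝔠₂` (derived prefactor) is the pair form at the printed §9 design**:
`𝔠₂ᶜ = pairForm (5/2) (3/2) 0.5 0.498 ῑ₄ ῑ₃` (longer component `P₂ = P^{0.5}` with `β₇`, coefficient `ῑ₄`;
shorter `P₃ = P^{0.498}` with `β₆`, coefficient `ῑ₃`; (9.2)). [cite: Zhang2022LandauSiegel, (9.7)] -/
theorem frakc2c_eq_pairForm : frakc2c = pairForm (5/2) (3/2) 0.5 0.498 (conj iota4) (conj iota3) := by
  unfold frakc2c pairForm c43c
  rw [c33_eq_cDiag, c44_eq_cDiag, c34c_eq_cCross]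
  simp only [Complex.conj_conj, Complex.normSq_conj]
  ring

/-- `𝔠₂` with the PRINTED prefactor, in terms of the functional: the cross entries carry the extra factor
`125/126`. [cite: Zhang2022LandauSiegel, (9.7)] -/
theorem frakc2_eq : frakc2 = (Complex.normSq iota3 : ℂ) * cDiag (3/2) 0.498
    + iota3 * conj iota4 * (((125 / 126 : ℝ) : ℂ) * cCross (5/2) (3/2) 0.5 0.498)
    + iota4 * conj iota3 * conj (((125 / 126 : ℝ) : ℂ) * cCross (5/2) (3/2) 0.5 0.498)
    + (Complex.normSq iota4 : ℂ) * cDiag (5/2) 0.5 := by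
  unfold frakc2 c43
  rw [c33_eq_cDiag, c44_eq_cDiag, c34_eq_smul_c34c, c34c_eq_cCross]

/-! ### Algebraic facts: the form is real, its diagonal entries are real -/

/-- `conj c_μμ = c_μμ` (the diagonal constants are real; §8 compares `𝔠₁` with `6.9955`).
[cite: Zhang2022LandauSiegel, §8 after (8.23) p.50] -/
theorem conj_cDiag (k : ℚ) (ν : ℝ) : conj (cDiag k ν) = cDiag k ν := by
  unfold cDiag; simp only [map_add, Complex.conj_conj]; ring

/-- the pair form is self-conjugate. [cite: Zhang2022LandauSiegel, §8 after (8.23) p.50, §9 after (9.7) p.52] -/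
theorem conj_pairForm (kL kS : ℚ) (νL νS : ℝ) (uL uS : ℂ) :
    conj (pairForm kL kS νL νS uL uS) = pairForm kL kS νL νS uL uS := by
  unfold pairForm
  simp only [map_add, map_mul, Complex.conj_conj, Complex.conj_ofReal, conj_cDiag]
  ring

/-- the pair form is real-valued: `Im = 0` (so `𝔠₁`, `𝔠₂` are real for every design, as (8.24)/(9.8) presuppose).
[cite: Zhang2022LandauSiegel, (8.24) p.50, (9.8) p.52] -/
theorem pairForm_im (kL kS : ℚ) (νL νS : ℝ) (uL uS : ℂ) : (pairForm kL kS νL νS uL uS).im = 0 :=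
  Complex.conj_eq_iff_im.mp (conj_pairForm kL kS νL νS uL uS)

/-- `Re` of the pair form written out: `|u_L|² Re c_LL + 2 Re(u_L ū_S c_LS) + |u_S|² Re c_SS`.
[cite: Zhang2022LandauSiegel, §8 after (8.23) p.50, §9 after (9.7) p.52] -/
theorem pairForm_re (kL kS : ℚ) (νL νS : ℝ) (uL uS : ℂ) :
    (pairForm kL kS νL νS uL uS).re = Complex.normSq uL * (cDiag kL νL).re
      + 2 * (uL * conj uS * cCross kL kS νL νS).re + Complex.normSq uS * (cDiag kS νS).re := by
  have h : conj uL * uS * conj (cCross kL kS νL νS) = conj (uL * conj uS * cCross kL kS νL νS) := by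
    simp only [map_mul, Complex.conj_conj]
  unfold pairForm
  rw [h]
  simp only [Complex.add_re, Complex.mul_re, Complex.ofReal_re, Complex.ofReal_im, Complex.conj_re,
    Complex.conj_im, zero_mul, sub_zero]
  ring

end Literature.NumberTheory.LFunctions.Zhang2022
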